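import Summits.BirchSwinnertonDyer.BirchSwinnertonDyer.Theorems.EisensteinPrimesBSDpOnCellCEtaleChainEnd
import Summits.BirchSwinnertonDyer.Rank1Residual.X2.GreenbergVatsalTateDatumTorsion
import Literature.NumberTheory.EllipticCurves.WeilPairingProofs
import HarnessLib

/-!
# Crux 4 `BSDpOnCellC` (stmt-BirchSwinnertonDyer-19034), line b1, stub `stub_ctlOrSwitch` — the
# chain-end lemma made HYPOTHESIS-FREE at every ODD prime: `D_p` never fixes all of `W[p]`
# (cell `bsd-eis`, seat `bsd-eis-k5-c4` g4; THEOREMS ONLY, `--supports stmt-BirchSwinnertonDyer-19034`)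

HONEST FRAMING (cell `bsd-eis`, run/shared/lean/pub/bsd-eis/): theorems only; nothing booked; X2
stays CONSTRUCTION-SHAPED; no label or count moves; closes nothing (k5-c4-MEMO-2 §2 (D), variant V3).

The chain-end lemma `EtaleChainEnd.forall_torsion_eq_zero_of_no_etaleLine` (p474720) carries one
hypothesis `hD : ¬ ∀ g ∈ decomp v, ∀ P : W[p], g • P = P` — "the decomposition group at `p` does not
fix ALL of the `p`-torsion". This file DISCHARGES it for every elliptic `W/ℚ` at every ODD prime
`p`, from two tree theorems: the Weil pairing (`WeierstrassCurve.exists_weilPairing_holds`: a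
Galois-equivariant, non-degenerate pairing `W[p] × W[p] → μ_p`, Silverman AEC III.8.1) and local
Kronecker–Weber on inertia (`GreenbergVatsalTateDatumTorsion.exists_mem_absInertia_cyclotomicCharacter_eq_natCast`:
an inertia element `σ₀ ∈ I_{ℚ_p}` with `χ_p(σ₀) = 2`). If `D_p` fixed `W[p]` pointwise it would fix
every Weil value, in particular a primitive `p`-th root of unity `ζ` (non-degeneracy + `#W[p] = p² >
1`), whereas `σ₀ ζ = ζ²  ≠ ζ` for `p` odd.

* `not_forall_decomp_smul_eq_of_odd` — **`hD` holds at every odd `p`**;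
* `exists_etaleLine_of_torsion_ne_zero_of_odd`, `forall_torsion_eq_zero_of_no_etaleLine_of_odd` —
  the two main statements of p474720 with `hD` removed (`p ≠ 2`).

References: [SilvermanAEC2009] Prop. III.8.1; [SerreLocalFields1979] Ch. IV §4 Prop. 17;
[GreenbergLNM1716] §3 Lemma 3.1; k5-c4-MEMO-2 §2 (D).
-/

set_option autoImplicit false
-- the route's Theorems namespace `Summit.BirchSwinnertonDyer.BirchSwinnertonDyer.Theorems` (summit = problem) trips the linter
set_option linter.dupNamespace false

noncomputable section

open scoped Classical

open WeierstrassCurve NumberField IsDedekindDomain Field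
open Literature.NumberTheory.EllipticCurves Literature.NumberTheory.EllipticCurves.GreenbergSelmer
  Literature.NumberTheory.GaloisRepresentations
  Summit.BirchSwinnertonDyer.Rank1Residual.X11b
  Summit.BirchSwinnertonDyer.Rank1Residual.X2

namespace Summit.BirchSwinnertonDyer.BirchSwinnertonDyer.Theorems.EtaleChainEnd

variable (W : WeierstrassCurve ℚ) [W.IsElliptic] (p : ℕ) [hp : Fact p.Prime]

/-- **At an odd prime `p`, the decomposition group `D_v` (`v ∋ p`) does NOT fix all of `W[p]`**
(Weil pairing + an inertia element with `χ_p = 2`). [cite: SilvermanAEC2009, Prop. III.8.1 (a),(c),(d)]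
[cite: SerreLocalFields1979, Ch. IV §4 Prop. 17] -/
theorem not_forall_decomp_smul_eq_of_odd (hp2 : p ≠ 2) {v : HeightOneSpectrum (𝓞 ℚ)}
    (hpv : ((p : ℕ) : 𝓞 ℚ) ∈ v.asIdeal) :
    ¬ ∀ g ∈ decomp (K := ℚ) v, ∀ P : geomTorsion W (p : ℤ), g • P = P := by
  intro hall
  have hpp : p.Prime := hp.out
  -- the Weil pairing on `W[p]`
  obtain ⟨w, hpow, -, -, -, hnd, hgal⟩ :=
    exists_weilPairing_holds W p hpp.two_le (by exact_mod_cast hpp.ne_zero)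
  -- some value is a non-trivial `p`-th root of unity (non-degeneracy, `#W[p] = p² > 1`)
  have hex : ∃ S T : geomTorsion W (p : ℤ), w S T ≠ 1 := by
    by_contra h
    push Not at h
    have h0 : ∀ T : geomTorsion W (p : ℤ), T = 0 := fun T ↦ hnd T fun S ↦ h S T
    haveI : Subsingleton (geomTorsion W (p : ℤ)) := ⟨fun a b ↦ by rw [h0 a, h0 b]⟩
    have hcard : Nat.card (geomTorsion W (p : ℤ)) = p ^ 2 := natCard_geomTorsion_eq_sq W p
    have hle : Nat.card (geomTorsion W (p : ℤ)) = 1 :=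
      Nat.card_of_subsingleton (0 : geomTorsion W (p : ℤ))
    have h1 : 1 < p ^ 2 := Nat.one_lt_pow two_ne_zero hpp.one_lt
    omega
  obtain ⟨S, T, hST⟩ := hex
  -- an inertia element `σ₀` above `v` with `χ_p(σ₀) = 2`
  obtain ⟨σ₀, hσ₀I, hχ⟩ :=
    GreenbergVatsalTateDatumTorsion.exists_mem_absInertia_cyclotomicCharacter_eq_natCast p hpv
      (N := 2) fun h ↦ hp2 ((Nat.prime_dvd_prime_iff_eq hpp Nat.prime_two).mp h)
  set g : absoluteGaloisGroup ℚ := absGaloisRestrict ℚ (v.adicCompletion ℚ) σ₀ with hg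
  have hgD : g ∈ decomp (K := ℚ) v := inertia_le_decomp v (Subgroup.mem_map_of_mem _ hσ₀I)
  -- `g` fixes the Weil value `ζ = w S T`
  have hfix : g • w S T = w S T := by rw [hgal g S T, hall g hgD S, hall g hgD T]
  -- read in `\bar ℚ_v`: `σ₀ • ζ' = ζ'` with `ζ' ^ p = 1`, but `σ₀ • ζ' = ζ' ^ 2`
  set ζ' : AlgebraicClosure (v.adicCompletion ℚ) :=
    absClosureEmbedding ℚ (v.adicCompletion ℚ) (w S T) with hζ'
  have hσζ : σ₀ • ζ' = ζ' := by
    rw [hζ', ← absGaloisRestrict_apply_smul, ← hg, hfix]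
  have hζp : ζ' ^ p ^ 1 = 1 := by
    rw [pow_one, hζ', ← map_pow, hpow S T, map_one]
  haveI : NeZero ((p : ℕ) : v.adicCompletion ℚ) := ⟨by
    rw [← map_natCast (algebraMap ℚ (v.adicCompletion ℚ))]
    exact (map_ne_zero_iff _ (algebraMap ℚ (v.adicCompletion ℚ)).injective).mpr
      (Nat.cast_ne_zero.mpr hpp.ne_zero)⟩
  have hpp2 : 2 < p := lt_of_le_of_ne hpp.two_le (Ne.symm hp2)
  have hσζ2 : σ₀ • ζ' = ζ' ^ 2 := by
    rw [GaloisRep.cyclotomicCharacter_spec (v.adicCompletion ℚ) p σ₀ _ hζp, hχ, map_natCast,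
      ZMod.val_natCast, pow_one, Nat.mod_eq_of_lt hpp2]
  -- hence `ζ' ^ 2 = ζ'`, so `ζ' = 1` (`ζ' ≠ 0`), so `ζ = 1`: contradiction
  have hζ0 : ζ' ≠ 0 := by
    intro h0
    rw [h0, pow_one, zero_pow hpp.ne_zero] at hζp
    exact zero_ne_one hζp
  have hζ1 : ζ' = 1 := by
    have h2 : ζ' ^ 2 = ζ' := by rw [← hσζ2, hσζ]
    have h3 : ζ' * (ζ' - 1) = 0 := by rw [mul_sub, mul_one, ← pow_two, h2, sub_self]
    rcases mul_eq_zero.mp h3 with h | h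
    · exact absurd h hζ0
    · exact sub_eq_zero.mp h
  apply hST
  apply (absClosureEmbedding ℚ (v.adicCompletion ℚ)).injective
  rw [map_one]
  exact hζ1

variable {K : Type} [Field K] [NumberField K]

/-- **`exists_etaleLine_of_torsion_ne_zero` at an odd prime, hypothesis-free**: a nonzero
`K`-rational point killed by `p` (for `K` imaginary quadratic with `p` split) yields a `Γ_ℚ`-stable
order-`p` subgroup of `W[p]` fixed pointwise by `D_v` — the kernel of one more ÉTALE step of the
ℚ-rational `p`-isogeny chain. [cite: GreenbergLNM1716, §3 Lemma 3.1 (p. 86)]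
[cite: NeukirchANT1999, Ch. I §9 (9.3)] -/
theorem exists_etaleLine_of_torsion_ne_zero_of_odd (hp2 : p ≠ 2) (hK : IsImaginaryQuadratic K)
    (hs : SplitsIn K p) {𝔭 : HeightOneSpectrum (𝓞 K)} (h𝔭 : ((p : ℕ) : 𝓞 K) ∈ 𝔭.asIdeal)
    {v : HeightOneSpectrum (𝓞 ℚ)} (hpv : ((p : ℕ) : 𝓞 ℚ) ∈ v.asIdeal)
    {Q : (W.baseChange K).toAffine.Point} (hQ : p • Q = 0) (hQ0 : Q ≠ 0) :
    ∃ Φ : AddSubgroup (geomTorsion W (p : ℤ)), Nat.card Φ = p ∧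
      (∀ σ : absoluteGaloisGroup ℚ, ∀ P ∈ Φ, σ • P ∈ Φ) ∧
        (∀ g ∈ decomp (K := ℚ) v, ∀ P ∈ Φ, g • P = P) :=
  exists_etaleLine_of_torsion_ne_zero W p hK hs h𝔭 hpv
    (not_forall_decomp_smul_eq_of_odd W p hp2 hpv) hQ hQ0

/-- **CHAIN-END LEMMA at an odd prime, hypothesis-free**: if `W/ℚ` admits NO `Γ_ℚ`-stable order-`p`
subgroup of `W[p]` fixed pointwise by `D_v` (end of the ℚ-rational étale chain), then
`∀ Q ∈ W(K), p • Q = 0 → Q = 0` for EVERY imaginary quadratic `K` in which `p` splits — the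
hypothesis `hivK0` of `X2.natCard_selmerAcBase_mul_eq_of_rankOne_of_noTorsion`; so the torsion
residual of `stub_ctlOrSwitch` is control with LOCAL `p`-torsion only (k5-c4-MEMO-2).
[cite: GreenbergLNM1716, §3 Lemma 3.1 (p. 86)] [cite: NeukirchANT1999, Ch. I §9 (9.3)] -/
theorem forall_torsion_eq_zero_of_no_etaleLine_of_odd (hp2 : p ≠ 2) (hK : IsImaginaryQuadratic K)
    (hs : SplitsIn K p) {v : HeightOneSpectrum (𝓞 ℚ)} (hpv : ((p : ℕ) : 𝓞 ℚ) ∈ v.asIdeal)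
    (hno : ¬ ∃ Φ : AddSubgroup (geomTorsion W (p : ℤ)), Nat.card Φ = p ∧
      (∀ σ : absoluteGaloisGroup ℚ, ∀ P ∈ Φ, σ • P ∈ Φ) ∧
        (∀ g ∈ decomp (K := ℚ) v, ∀ P ∈ Φ, g • P = P)) :
    ∀ Q : (W.baseChange K).toAffine.Point, p • Q = 0 → Q = 0 :=
  forall_torsion_eq_zero_of_no_etaleLine' W p hK hs hpv
    (not_forall_decomp_smul_eq_of_odd W p hp2 hpv) hno

end Summit.BirchSwinnertonDyer.BirchSwinnertonDyer.Theorems.EtaleChainEnd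

end
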